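import Literature.Probability.RandomPlanarGeometry.ChordalCurveFamily
import Literature.Probability.RandomPlanarGeometry.CurveMonotoneReparam
import HarnessLib

/-!
# Representative independence of the initial and final segments of a curve class

This file discharges the two named facts of `ChordalCurveFamily.lean` on curve surgery modulo
reparametrisation,

* `Literature.Probability.RandomPlanarGeometry.CurveClass.stopAt_mk` (`CurveClass.stopAt_mk_holds`):
  for closed `F`, `CurveClass.stopAt F (mk γ) = mk (γ.stopAt F)`;
* `Literature.Probability.RandomPlanarGeometry.CurveClass.startFrom_mk`
  (`CurveClass.startFrom_mk_holds`): for closed `F`, `CurveClass.startFrom F (mk γ) = mk (γ.startFrom F)`,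

i.e. the initial segment up to, and the final segment from, the first hitting of a closed set `F`,
taken modulo increasing reparametrisation, do not depend on the representative of the class of
`γ` (the class-level operations are defined through a chosen representative `CurveClass.out`).

## The argument (Fréchet re-parametrisation folklore)

The content is `Curve.dist_stopAt_stopAt_eq_zero` / `Curve.dist_startFrom_startFrom_eq_zero`: if
`dist γ₁ γ₂ = 0` for the reparametrisation pseudo-distance and `F` is closed then the initial
(resp. final) segments of `γ₁`, `γ₂` are again at distance `0`.  Write `Tᵢ` for the first
hitting parameters.

* If `γ₂` never meets `F`, neither does `γ₁` (curves at distance `0` have the same trace), both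
  hitting parameters are `1`, the initial segments are the curves themselves and the final
  segments are the constant curves at the common target.
* Otherwise (`Curve.exists_reparam_pause`) choose reparametrisations `φₙ` with
  `sup_t dist (γ₁ t) (γ₂ (φₙ t)) < 1/(n+1)` and let `sₙ := φₙ⁻¹ T₂` (the hitting parameter of
  `γ₂ ∘ φₙ`); along a subsequence `sₙ → s⋆`.  Then `γ₁ s⋆ = γ₂ T₂ ∈ F`, so `T₁ ≤ s⋆`, and `γ₁` is
  **constant on `[T₁, s⋆]`**: for `T₁ ≤ t < s⋆`, eventually `φₙ T₁ ≤ φₙ t < T₂`, while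
  `φₙ T₁ → T₂` because `γ₂ (φₙ T₁) → γ₁ T₁ ∈ F` and `γ₂` stays at positive distance from `F` on
  every `[0, T₂ - δ]` (compactness).
* The tail of `γ₁` from `sₙ` is uniformly `1/(n+1)`-close to the tail of `γ₂ ∘ φₙ` from `sₙ`,
  which is a monotone reparametrisation of the tail of `γ₂` from `T₂`; tails depend continuously
  on the starting parameter; and the tail of `γ₁` from `T₁` is a monotone reparametrisation of its
  tail from `s⋆` (the pause on `[T₁, s⋆]` is invisible modulo reparametrisation).  Monotone
  reparametrisations are at distance `0` (`Curve.reparamDist_eq_zero_of_monotone'`, file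
  `CurveMonotoneReparam.lean`), and the triangle inequality concludes.  Heads (initial segments)
  are treated in exactly the same way.

## Contents

* `Curve.isClosed_hitSet`, `Curve.hitParam_mem_hitSet`, `Curve.apply_hitParam_mem`: for closed `F`
  the infimum defining `hitParam` is attained.
* `Curve.dist_comp_comp_le_dist`, `Curve.exists_dist_comp_affineClamp_le`,
  `Curve.tendsto_dist_comp_affineClamp`: metric lemmas on clamped affine reparametrisations
  `γ ∘ affineClamp a b`; `Curve.dist_tail_reparam_tail_eq_zero`,
  `Curve.dist_tail_tail_eq_zero_of_const`, `Curve.dist_head_reparam_head_eq_zero`,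
  `Curve.dist_head_head_eq_zero_of_const`: the monotone-reparametrisation identities.
* `Curve.exists_reparam_pause` (the common core), `Curve.dist_startFrom_startFrom_eq_zero`,
  `Curve.dist_stopAt_stopAt_eq_zero`, `CurveClass.startFrom_mk_holds`, `CurveClass.stopAt_mk_holds`.

Sources: M. Aizenman, A. Burchard, Duke Math. J. 99 (1999) §2.1 (the curve space); the statements
themselves are folklore (see the docstring of `CurveClass.stopAt_mk`).
-/

noncomputable section

open Set Filter Topology Metric
open scoped unitInterval

namespace Literature.Probability.RandomPlanarGeometry

namespace Curve

/-! ### The hitting parameter of a closed set is attained -/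

section Topological

variable {E : Type*} [TopologicalSpace E]

/-- For closed `F` the set of hitting parameters (together with `1`) is closed: it is the image
of the compact set `γ ⁻¹' F ⊆ [0, 1]` together with the point `1`. [folklore] -/
theorem isClosed_hitSet {F : Set E} (hF : IsClosed F) (γ : Curve E) : IsClosed (γ.hitSet F) := by
  have h : {t : ℝ | ∃ h : t ∈ I, γ ⟨t, h⟩ ∈ F} = Subtype.val '' ((γ : I → E) ⁻¹' F) := by
    ext t
    constructor
    · rintro ⟨ht, hmem⟩
      exact ⟨⟨t, ht⟩, hmem, rfl⟩
    · rintro ⟨u, hu, rfl⟩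
      exact ⟨u.2, hu⟩
  unfold hitSet
  rw [h]
  exact (((hF.preimage γ.continuous).isCompact.image continuous_subtype_val).isClosed).union
    isClosed_singleton

/-- For closed `F` the hitting parameter belongs to the hit set (the infimum of a closed,
nonempty, bounded below set of reals is attained). [folklore] -/
theorem hitParam_mem_hitSet {F : Set E} (hF : IsClosed F) (γ : Curve E) :
    γ.hitParam F ∈ γ.hitSet F :=
  (isClosed_hitSet hF γ).csInf_mem ⟨1, γ.one_mem_hitSet F⟩
    ⟨0, fun _ ht => (γ.hitSet_subset_Icc F ht).1⟩

/-- For closed `F` met by the curve, the curve is in `F` at its first hitting parameter.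
[folklore] -/
theorem apply_hitParam_mem {F : Set E} (hF : IsClosed F) {γ : Curve E} (h : ∃ t, γ t ∈ F) :
    γ ⟨γ.hitParam F, γ.hitParam_mem_Icc F⟩ ∈ F := by
  rcases hitParam_mem_hitSet hF γ with ⟨hI, hmem⟩ | h1
  · exact hmem
  · obtain ⟨t, ht⟩ := h
    have h1' : γ.hitParam F = 1 := mem_singleton_iff.1 h1
    have heq : (t : ℝ) = γ.hitParam F :=
      le_antisymm (by rw [h1']; exact t.2.2) (hitParam_le ht)
    have : t = ⟨γ.hitParam F, γ.hitParam_mem_Icc F⟩ := Subtype.ext heq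
    rw [← this]
    exact ht

/-- Before the first hitting parameter the curve is not in `F`. [folklore] -/
theorem notMem_of_lt_hitParam {F : Set E} {γ : Curve E} {t : I} (ht : (t : ℝ) < γ.hitParam F) :
    γ t ∉ F :=
  fun h => absurd (hitParam_le h) (not_le.2 ht)

/-- A curve that never meets `F` has hitting parameter `1`. [folklore] -/
theorem hitParam_eq_one_of_forall_notMem {F : Set E} {γ : Curve E} (h : ∀ t, γ t ∉ F) :
    γ.hitParam F = 1 := by
  have hset : γ.hitSet F = {1} := by
    refine Set.eq_singleton_iff_unique_mem.2 ⟨γ.one_mem_hitSet F, fun t ht => ?_⟩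
    rcases ht with ⟨hI, hmem⟩ | ht
    · exact absurd hmem (h _)
    · exact ht
  show sInf (γ.hitSet F) = 1
  rw [hset, csInf_singleton]

/-- A curve with hitting parameter `1` has the constant curve at its target as final segment.
[folklore] -/
theorem startFrom_eq_const_of_hitParam_eq_one {F : Set E} {γ : Curve E} (h : γ.hitParam F = 1) :
    γ.startFrom F = const γ.target := by
  refine Curve.ext (ContinuousMap.ext fun s => ?_)
  show γ.startFrom F s = γ.target
  rw [startFrom_apply, h, target_def]
  simp [projIcc_right]

/-- A curve with hitting parameter `1` is its own initial segment. [folklore] -/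
theorem stopAt_eq_self_of_hitParam_eq_one {F : Set E} {γ : Curve E} (h : γ.hitParam F = 1) :
    γ.stopAt F = γ := by
  refine Curve.ext (ContinuousMap.ext fun s => ?_)
  show γ.stopAt F s = γ s
  rw [stopAt_apply, h, one_mul, projIcc_val]

/-- The final segment written as a tail `γ ∘ affineClamp t (1 - t)` for any `t : I` whose value
is the hitting parameter. [folklore] -/
theorem startFrom_eq_of_coe_eq {F : Set E} {γ : Curve E} {t : I} (h : (t : ℝ) = γ.hitParam F) :
    γ.startFrom F = ⟨γ.toContinuousMap.comp (affineClamp t (1 - t))⟩ := by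
  rw [h]
  rfl

/-- The initial segment written as a head `γ ∘ affineClamp 0 t` for any `t : I` whose value is
the hitting parameter. [folklore] -/
theorem stopAt_eq_of_coe_eq {F : Set E} {γ : Curve E} {t : I} (h : (t : ℝ) = γ.hitParam F) :
    γ.stopAt F = ⟨γ.toContinuousMap.comp (affineClamp 0 t)⟩ := by
  rw [h]
  rfl

end Topological

/-! ### Metric lemmas on clamped affine reparametrisations `γ ∘ affineClamp a b` -/

section PseudoMetric

variable {E : Type*} [PseudoMetricSpace E]

/-- Precomposing two curves with the same parameter change does not increase the sup distance,
hence the reparametrisation distance of the results is at most the sup distance. [folklore] -/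
theorem dist_comp_comp_le_dist (γ η : Curve E) (f : C(I, I)) :
    dist (⟨γ.toContinuousMap.comp f⟩ : Curve E) ⟨η.toContinuousMap.comp f⟩ ≤
      dist γ.toContinuousMap η.toContinuousMap :=
  (dist_le_dist_toContinuousMap _ _).trans
    ((ContinuousMap.dist_le dist_nonneg).2 fun u => ContinuousMap.dist_apply_le_dist (f u))

/-- Clamped affine reparametrisations of a fixed curve depend (uniformly) continuously on the
two parameters: uniform continuity of `γ` on `[0, 1]` and the `1`-Lipschitz property of
`projIcc`. [folklore] -/
theorem exists_dist_comp_affineClamp_le (γ : Curve E) {ε : ℝ} (hε : 0 < ε) :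
    ∃ δ > 0, ∀ a b a' b' : ℝ, |a - a'| ≤ δ → |b - b'| ≤ δ →
      dist (⟨γ.toContinuousMap.comp (affineClamp a b)⟩ : Curve E)
        ⟨γ.toContinuousMap.comp (affineClamp a' b')⟩ ≤ ε := by
  obtain ⟨δ, hδ, hγ⟩ := Metric.uniformContinuous_iff.1
    (CompactSpace.uniformContinuous_of_continuous γ.continuous) ε hε
  refine ⟨δ / 3, by positivity, fun a b a' b' ha hb => ?_⟩
  refine (dist_le_dist_toContinuousMap _ _).trans
    ((ContinuousMap.dist_le hε.le).2 fun u => (hγ ?_).le)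
  show dist (affineClamp a b u) (affineClamp a' b' u) < δ
  rw [Subtype.dist_eq, Real.dist_eq, affineClamp_apply, affineClamp_apply]
  refine (Set.abs_projIcc_sub_projIcc zero_le_one).trans_lt ?_
  rw [show a + b * (u : ℝ) - (a' + b' * u) = (a - a') + (b - b') * u by ring]
  calc |(a - a') + (b - b') * (u : ℝ)| ≤ |a - a'| + |(b - b') * (u : ℝ)| := abs_add_le _ _
    _ = |a - a'| + |b - b'| * (u : ℝ) := by
        rw [abs_mul, abs_of_nonneg (unitInterval.nonneg u)]
    _ ≤ δ / 3 + δ / 3 * 1 :=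
        add_le_add ha (mul_le_mul hb (unitInterval.le_one u) (unitInterval.nonneg u)
          (by positivity))
    _ < δ := by linarith

/-- Along a convergent sequence of parameters `s k → s⋆`, the clamped affine reparametrisations
`γ ∘ affineClamp (a (s k)) (b (s k))` converge to `γ ∘ affineClamp (a s⋆) (b s⋆)` for the
reparametrisation distance, for `1`-Lipschitz coefficient maps `a`, `b` (used with
`(a, b) = (s, 1 - s)` for tails and `(0, s)` for heads). [folklore] -/
theorem tendsto_dist_comp_affineClamp (γ : Curve E) {s : ℕ → I} {sStar : I}
    (hlim : Tendsto s atTop (𝓝 sStar)) (a b : I → ℝ)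
    (ha : ∀ u v : I, |a u - a v| ≤ |(u : ℝ) - v|) (hb : ∀ u v : I, |b u - b v| ≤ |(u : ℝ) - v|) :
    Tendsto (fun k => dist (⟨γ.toContinuousMap.comp (affineClamp (a sStar) (b sStar))⟩ : Curve E)
      ⟨γ.toContinuousMap.comp (affineClamp (a (s k)) (b (s k)))⟩) atTop (𝓝 0) := by
  refine Metric.tendsto_nhds.2 fun ε hε => ?_
  obtain ⟨δ, hδ, hmod⟩ := exists_dist_comp_affineClamp_le γ (half_pos hε)
  filter_upwards [Metric.tendsto_nhds.1 hlim δ hδ] with k hk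
  rw [Real.dist_0_eq_abs, abs_of_nonneg dist_nonneg]
  have hk' : |(sStar : ℝ) - s k| ≤ δ := by
    rw [Subtype.dist_eq, Real.dist_eq, abs_sub_comm] at hk
    exact hk.le
  exact (hmod _ _ _ _ ((ha _ _).trans hk') ((hb _ _).trans hk')).trans_lt (half_lt_self hε)

/-- A point at vanishing distance from a sequence which approaches another point is at
distance `0` from that point (triangle inequality in the limit). [folklore] -/
theorem dist_eq_zero_of_tendsto {α : Type*} [PseudoMetricSpace α] {x y : α} (B : ℕ → α)
    (h₁ : Tendsto (fun k => dist x (B k)) atTop (𝓝 0))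
    (h₂ : Tendsto (fun k => dist (B k) y) atTop (𝓝 0)) : dist x y = 0 := by
  have h : Tendsto (fun k => dist x (B k) + dist (B k) y) atTop (𝓝 0) := by
    simpa using h₁.add h₂
  exact le_antisymm (ge_of_tendsto' h fun k => dist_triangle _ _ _) dist_nonneg

/-- If `φ s₀ = t₀` then the tail from `s₀` of the reparametrised curve `γ ∘ φ` is a monotone
reparametrisation of the tail of `γ` from `t₀`, hence at reparametrisation distance `0`.
[folklore] -/
theorem dist_tail_reparam_tail_eq_zero (γ : Curve E) (φ : I ≃o I) (s₀ t₀ : I) (h : φ s₀ = t₀) :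
    dist (⟨(γ.reparam φ).toContinuousMap.comp (affineClamp s₀ (1 - s₀))⟩ : Curve E)
      ⟨γ.toContinuousMap.comp (affineClamp t₀ (1 - t₀))⟩ = 0 := by
  rw [dist_def]
  refine reparamDist_eq_zero_of_monotone' (m := 1 - (t₀ : ℝ)) (unitInterval.one_minus_nonneg t₀)
    (V := fun x => γ (projIcc 0 1 zero_le_one ((t₀ : ℝ) + x)))
    (h₁ := fun u => ((φ (projIcc 0 1 zero_le_one ((s₀ : ℝ) + (1 - s₀) * u)) : I) : ℝ) - t₀)
    (h₂ := fun u => (1 - (t₀ : ℝ)) * u)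
    ?_ ?_ ?_ ?_ ?_ ?_ ?_ ?_ ?_ ?_ ?_
  · exact (γ.continuous.comp (continuous_projIcc.comp (continuous_const.add continuous_id))).continuousOn
  · exact (continuous_subtype_val.comp
      (φ.continuous.comp (continuous_projIcc.comp (by fun_prop)))).sub continuous_const
  · fun_prop
  · intro u v huv
    refine sub_le_sub_right (Subtype.coe_le_coe.2 (φ.monotone (monotone_projIcc _ ?_))) _
    exact add_le_add le_rfl (mul_le_mul_of_nonneg_left huv (unitInterval.one_minus_nonneg s₀))
  · exact fun u v huv => mul_le_mul_of_nonneg_left huv (unitInterval.one_minus_nonneg t₀)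
  · simp [h]
  · simp
  · have h1 : projIcc (0 : ℝ) 1 zero_le_one ((s₀ : ℝ) + (1 - s₀) * 1) = ⊤ := by
      rw [mul_one, add_sub_cancel, projIcc_right]
      rfl
    show ((φ (projIcc 0 1 zero_le_one ((s₀ : ℝ) + (1 - s₀) * 1)) : I) : ℝ) - t₀ = 1 - t₀
    rw [h1, OrderIso.map_top]
    rfl
  · simp
  · intro u
    show γ (φ (projIcc 0 1 zero_le_one ((s₀ : ℝ) + (1 - s₀) * u))) = _
    simp only [add_sub_cancel, projIcc_val]
  · intro u
    rfl

/-- **Pause removal (tails).** If `γ` is constant on `[a, b]` then its tail from `a` is a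
monotone reparametrisation of its tail from `b` (run through the pause first), hence the two
tails are at reparametrisation distance `0`. [folklore] -/
theorem dist_tail_tail_eq_zero_of_const (γ : Curve E) (a b : I) (hab : a ≤ b)
    (hconst : ∀ t : I, a ≤ t → t ≤ b → γ t = γ b) :
    dist (⟨γ.toContinuousMap.comp (affineClamp a (1 - a))⟩ : Curve E)
      ⟨γ.toContinuousMap.comp (affineClamp b (1 - b))⟩ = 0 := by
  rw [dist_def]
  have hab' : (a : ℝ) ≤ b := hab
  refine reparamDist_eq_zero_of_monotone' (m := 1 - (b : ℝ)) (unitInterval.one_minus_nonneg b)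
    (V := fun x => γ (projIcc 0 1 zero_le_one ((b : ℝ) + x)))
    (h₁ := fun u => max 0 ((a : ℝ) - b + (1 - a) * u))
    (h₂ := fun u => (1 - (b : ℝ)) * u)
    ?_ ?_ ?_ ?_ ?_ ?_ ?_ ?_ ?_ ?_ ?_
  · exact (γ.continuous.comp (continuous_projIcc.comp (continuous_const.add continuous_id))).continuousOn
  · fun_prop
  · fun_prop
  · intro u v huv
    refine max_le_max le_rfl ?_
    exact add_le_add le_rfl (mul_le_mul_of_nonneg_left huv (unitInterval.one_minus_nonneg a))
  · exact fun u v huv => mul_le_mul_of_nonneg_left huv (unitInterval.one_minus_nonneg b)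
  · simp only [mul_zero, add_zero]
    exact max_eq_left (by linarith)
  · simp
  · rw [mul_one]
    exact (max_eq_right (by linarith [unitInterval.le_one b])).trans (by ring)
  · simp
  · intro u
    show γ (projIcc 0 1 zero_le_one ((a : ℝ) + (1 - a) * u)) = _
    set x : ℝ := (a : ℝ) + (1 - a) * u with hx
    have hax : (a : ℝ) ≤ x := by
      have := mul_nonneg (unitInterval.one_minus_nonneg a) (unitInterval.nonneg u)
      linarith
    have hx1 : x ≤ 1 := by
      have := mul_le_of_le_one_right (unitInterval.one_minus_nonneg a) (unitInterval.le_one u)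
      linarith
    have hmax : (b : ℝ) + max 0 ((a : ℝ) - b + (1 - a) * u) = max (b : ℝ) x := by
      rw [← max_add_add_left, add_zero]
      congr 1
      rw [hx]
      ring
    simp only [hmax]
    rcases le_or_gt (b : ℝ) x with hbx | hxb
    · rw [max_eq_right hbx]
    · rw [max_eq_left hxb.le, projIcc_val,
        projIcc_of_mem _ ⟨(unitInterval.nonneg a).trans hax, hx1⟩]
      exact hconst _ hax hxb.le
  · intro u
    rfl

/-- If `φ s₀ = t₀` then the head up to `s₀` of the reparametrised curve `γ ∘ φ` is a monotone
reparametrisation of the head of `γ` up to `t₀`, hence at reparametrisation distance `0`.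
[folklore] -/
theorem dist_head_reparam_head_eq_zero (γ : Curve E) (φ : I ≃o I) (s₀ t₀ : I) (h : φ s₀ = t₀) :
    dist (⟨(γ.reparam φ).toContinuousMap.comp (affineClamp 0 s₀)⟩ : Curve E)
      ⟨γ.toContinuousMap.comp (affineClamp 0 t₀)⟩ = 0 := by
  rw [dist_def]
  refine reparamDist_eq_zero_of_monotone' (m := (t₀ : ℝ)) (unitInterval.nonneg t₀)
    (V := fun x => γ (projIcc 0 1 zero_le_one x))
    (h₁ := fun u => ((φ (projIcc 0 1 zero_le_one (0 + (s₀ : ℝ) * u)) : I) : ℝ))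
    (h₂ := fun u => 0 + (t₀ : ℝ) * u)
    ?_ ?_ ?_ ?_ ?_ ?_ ?_ ?_ ?_ ?_ ?_
  · exact (γ.continuous.comp continuous_projIcc).continuousOn
  · exact continuous_subtype_val.comp (φ.continuous.comp (continuous_projIcc.comp (by fun_prop)))
  · fun_prop
  · intro u v huv
    refine Subtype.coe_le_coe.2 (φ.monotone (monotone_projIcc _ ?_))
    exact add_le_add le_rfl (mul_le_mul_of_nonneg_left huv (unitInterval.nonneg s₀))
  · exact fun u v huv => add_le_add le_rfl (mul_le_mul_of_nonneg_left huv (unitInterval.nonneg t₀))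
  · have h0 : projIcc (0 : ℝ) 1 zero_le_one (0 + (s₀ : ℝ) * 0) = ⊥ := by
      rw [mul_zero, add_zero, projIcc_left]
      rfl
    show ((φ (projIcc 0 1 zero_le_one (0 + (s₀ : ℝ) * 0)) : I) : ℝ) = 0
    rw [h0, OrderIso.map_bot]
    rfl
  · simp
  · show ((φ (projIcc 0 1 zero_le_one (0 + (s₀ : ℝ) * 1)) : I) : ℝ) = t₀
    rw [mul_one, zero_add, projIcc_val, h]
  · simp
  · intro u
    show γ (φ (projIcc 0 1 zero_le_one (0 + (s₀ : ℝ) * u))) = _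
    simp only [projIcc_val]
  · intro u
    rfl

/-- **Pause removal (heads).** If `γ` is constant on `[a, b]` then its head up to `b` is a
monotone reparametrisation of its head up to `a` (followed by the pause), hence the two heads
are at reparametrisation distance `0`. [folklore] -/
theorem dist_head_head_eq_zero_of_const (γ : Curve E) (a b : I) (hab : a ≤ b)
    (hconst : ∀ t : I, a ≤ t → t ≤ b → γ t = γ b) :
    dist (⟨γ.toContinuousMap.comp (affineClamp 0 a)⟩ : Curve E)
      ⟨γ.toContinuousMap.comp (affineClamp 0 b)⟩ = 0 := by
  rw [dist_def]
  have hab' : (a : ℝ) ≤ b := hab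
  refine reparamDist_eq_zero_of_monotone' (m := (a : ℝ)) (unitInterval.nonneg a)
    (V := fun x => γ (projIcc 0 1 zero_le_one x))
    (h₁ := fun u => 0 + (a : ℝ) * u)
    (h₂ := fun u => min (0 + (b : ℝ) * u) a)
    ?_ ?_ ?_ ?_ ?_ ?_ ?_ ?_ ?_ ?_ ?_
  · exact (γ.continuous.comp continuous_projIcc).continuousOn
  · fun_prop
  · fun_prop
  · exact fun u v huv => add_le_add le_rfl (mul_le_mul_of_nonneg_left huv (unitInterval.nonneg a))
  · intro u v huv
    exact min_le_min (add_le_add le_rfl (mul_le_mul_of_nonneg_left huv (unitInterval.nonneg b)))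
      le_rfl
  · simp
  · simp only [mul_zero, add_zero]
    exact min_eq_left (unitInterval.nonneg a)
  · simp
  · rw [mul_one, zero_add]
    exact min_eq_right hab'
  · intro u
    rfl
  · intro u
    show γ (projIcc 0 1 zero_le_one (0 + (b : ℝ) * u)) = _
    set x : ℝ := 0 + (b : ℝ) * u with hx
    have hx0 : 0 ≤ x := by
      have := mul_nonneg (unitInterval.nonneg b) (unitInterval.nonneg u)
      linarith
    have hxb : x ≤ b := by
      have := mul_le_of_le_one_right (unitInterval.nonneg b) (unitInterval.le_one u)
      linarith
    rcases le_or_gt x (a : ℝ) with hxa | hax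
    · simp only [min_eq_left hxa]
    · simp only [min_eq_right hax.le]
      rw [projIcc_val, projIcc_of_mem _ ⟨hx0, hxb.trans (unitInterval.le_one b)⟩,
        hconst a le_rfl hab]
      exact hconst _ hax.le hxb

end PseudoMetric

/-! ### The common core and the two main lemmas -/

section Metric

variable {E : Type*} [MetricSpace E]

/-- Curves at distance `0` meet the same closed sets (they have the same trace). [folklore] -/
theorem forall_notMem_of_dist_eq_zero {F : Set E} {γ₁ γ₂ : Curve E} (h : dist γ₁ γ₂ = 0)
    (h₂ : ∀ t, γ₂ t ∉ F) : ∀ t, γ₁ t ∉ F := fun t ht => by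
  have hmem : γ₁ t ∈ γ₂.range := by
    rw [← range_eq_of_dist_eq_zero h]
    exact ⟨t, rfl⟩
  obtain ⟨t', ht'⟩ := mem_range.1 hmem
  exact h₂ t' (ht' ▸ ht)

/-- **The common core (the pause lemma).** Let `dist γ₁ γ₂ = 0`, `F` closed and met by `γ₂`,
with hitting parameters `T₁`, `T₂`.  There are reparametrisations `φ k` with
`sup_t dist (γ₁ t) (γ₂ (φ k t)) < 1/(k+1)`, whose pulled-back hitting parameters
`s k := (φ k)⁻¹ T₂` converge to some `s⋆ ≥ T₁`, and `γ₁` is constant on `[T₁, s⋆]`.  See the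
module docstring. [folklore] -/
theorem exists_reparam_pause {F : Set E} (hF : IsClosed F) {γ₁ γ₂ : Curve E}
    (h : dist γ₁ γ₂ = 0) (hhit : ∃ t, γ₂ t ∈ F) :
    ∃ (t₁ t₂ sStar : I) (φ : ℕ → I ≃o I) (s : ℕ → I),
      (t₁ : ℝ) = γ₁.hitParam F ∧ (t₂ : ℝ) = γ₂.hitParam F ∧
      (∀ k, dist γ₁.toContinuousMap (γ₂.reparam (φ k)).toContinuousMap < 1 / ((k : ℝ) + 1)) ∧
      (∀ k, φ k (s k) = t₂) ∧ Tendsto s atTop (𝓝 sStar) ∧ t₁ ≤ sStar ∧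
      ∀ t : I, t₁ ≤ t → t ≤ sStar → γ₁ t = γ₁ sStar := by
  -- the hitting parameters as points of `I`
  obtain ⟨t₂, ht₂⟩ : ∃ t₂ : I, (t₂ : ℝ) = γ₂.hitParam F := ⟨⟨_, γ₂.hitParam_mem_Icc F⟩, rfl⟩
  obtain ⟨t₁, ht₁⟩ : ∃ t₁ : I, (t₁ : ℝ) = γ₁.hitParam F := ⟨⟨_, γ₁.hitParam_mem_Icc F⟩, rfl⟩
  have ht₂F : γ₂ t₂ ∈ F := by
    have := apply_hitParam_mem hF hhit
    rwa [show (⟨γ₂.hitParam F, γ₂.hitParam_mem_Icc F⟩ : I) = t₂ from Subtype.ext ht₂.symm] at this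
  have hFne : F.Nonempty := ⟨_, ht₂F⟩
  -- reparametrisations realising sup distance `< 1/(n+1)`
  have hpos : ∀ n : ℕ, dist γ₁ γ₂ < 1 / ((n : ℝ) + 1) := fun n => by rw [h]; positivity
  choose φ hφ using fun n => exists_dist_reparam_lt (hpos n)
  have hclose : ∀ n (u : I), dist (γ₁ u) (γ₂ (φ n u)) < 1 / ((n : ℝ) + 1) := fun n u =>
    (ContinuousMap.dist_apply_le_dist (f := γ₁.toContinuousMap)
      (g := (γ₂.reparam (φ n)).toContinuousMap) u).trans_lt (hφ n)
  -- the hitting parameters `sₙ = φₙ⁻¹ T₂` of the reparametrised curves, and a limit point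
  set s : ℕ → I := fun n => (φ n).symm t₂ with hs
  have hφs : ∀ n, φ n (s n) = t₂ := fun n => (φ n).apply_symm_apply t₂
  obtain ⟨sStar, ψ, hψ, hlim⟩ := CompactSpace.tendsto_subseq s
  have hrate : Tendsto (fun k => 1 / ((ψ k : ℝ) + 1)) atTop (𝓝 0) :=
    tendsto_one_div_add_atTop_nhds_zero_nat.comp hψ.tendsto_atTop
  -- `γ₁ s⋆ = γ₂ T₂ ∈ F`, so `T₁ ≤ s⋆`
  have hγ₁sStar : γ₁ sStar = γ₂ t₂ := by
    refine tendsto_nhds_unique ((γ₁.continuous.tendsto sStar).comp hlim) ?_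
    rw [tendsto_iff_dist_tendsto_zero]
    refine squeeze_zero (fun _ => dist_nonneg) (fun k => ?_) hrate
    have := hclose (ψ k) (s (ψ k))
    rw [hφs] at this
    exact this.le
  have hsStarF : γ₁ sStar ∈ F := hγ₁sStar ▸ ht₂F
  have hT₁le : t₁ ≤ sStar := by
    show (t₁ : ℝ) ≤ sStar
    rw [ht₁]
    exact hitParam_le hsStarF
  have ht₁F : γ₁ t₁ ∈ F := by
    have := apply_hitParam_mem hF ⟨sStar, hsStarF⟩
    rwa [show (⟨γ₁.hitParam F, γ₁.hitParam_mem_Icc F⟩ : I) = t₁ from Subtype.ext ht₁.symm] at this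
  -- `γ₁` is constant on `[T₁, s⋆]`
  have hconst : ∀ t : I, t₁ ≤ t → t ≤ sStar → γ₁ t = γ₁ sStar := by
    intro t ht₁t htle
    rcases htle.lt_or_eq with hlt | rfl
    swap
    · rfl
    rw [hγ₁sStar]
    refine eq_of_forall_dist_le fun ε hε => ?_
    -- uniform continuity of `γ₂`
    obtain ⟨δ, hδ, hγ₂⟩ := Metric.uniformContinuous_iff.1
      (CompactSpace.uniformContinuous_of_continuous γ₂.continuous) (ε / 2) (half_pos hε)
    -- `γ₂` stays quantitatively away from `F` up to parameter `T₂ - δ`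
    obtain ⟨η, hη, hfar⟩ :
        ∃ η > 0, ∀ u : I, (u : ℝ) ≤ t₂ - δ → η ≤ infDist (γ₂ u) F := by
      have hK : IsCompact {u : I | (u : ℝ) ≤ t₂ - δ} :=
        (isClosed_le continuous_subtype_val continuous_const).isCompact
      rcases Set.eq_empty_or_nonempty {u : I | (u : ℝ) ≤ t₂ - δ} with hKe | hKne
      · refine ⟨1, one_pos, fun u hu => ?_⟩
        have : u ∈ {u : I | (u : ℝ) ≤ t₂ - δ} := hu
        rw [hKe] at this
        exact this.elim
      · obtain ⟨u₀, hu₀, hmin⟩ := hK.exists_isMinOn hKne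
          ((continuous_infDist_pt F).comp γ₂.continuous).continuousOn
        refine ⟨infDist (γ₂ u₀) F, ?_, fun u hu => hmin hu⟩
        refine (hF.notMem_iff_infDist_pos hFne).1 (notMem_of_lt_hitParam ?_)
        have hu₀' : (u₀ : ℝ) ≤ t₂ - δ := hu₀
        rw [← ht₂]
        linarith
    -- choose `n = ψ k` with `t < sₙ` and `1/(n+1) < min (ε/2) η`
    obtain ⟨k, hk₁, hk₂⟩ := ((hlim.eventually_const_lt hlt).and
      (hrate.eventually_lt_const (lt_min (half_pos hε) hη))).exists
    have hk₁ : t < s (ψ k) := hk₁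
    -- `φₙ T₁` is within `δ` of `T₂`
    have hr : (t₂ : ℝ) - δ < φ (ψ k) t₁ := by
      refine lt_of_not_ge fun hcon => ?_
      have h1 := hfar (φ (ψ k) t₁) hcon
      have h2 : infDist (γ₂ (φ (ψ k) t₁)) F ≤ dist (γ₂ (φ (ψ k) t₁)) (γ₁ t₁) :=
        infDist_le_dist_of_mem ht₁F
      have h3 := hclose (ψ k) t₁
      rw [dist_comm] at h3
      linarith [min_le_right (ε / 2) η]
    have hφt_lt : ((φ (ψ k) t : I) : ℝ) < t₂ := by
      rw [← hφs (ψ k)]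
      exact Subtype.coe_lt_coe.2 ((φ (ψ k)).strictMono hk₁)
    have hφt_ge : ((φ (ψ k) t₁ : I) : ℝ) ≤ φ (ψ k) t :=
      Subtype.coe_le_coe.2 ((φ (ψ k)).monotone ht₁t)
    have hparam : dist (φ (ψ k) t) t₂ < δ := by
      rw [Subtype.dist_eq, Real.dist_eq, abs_sub_lt_iff]
      constructor <;> linarith
    calc dist (γ₁ t) (γ₂ t₂)
        ≤ dist (γ₁ t) (γ₂ (φ (ψ k) t)) + dist (γ₂ (φ (ψ k) t)) (γ₂ t₂) := dist_triangle _ _ _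
      _ ≤ ε / 2 + ε / 2 :=
          add_le_add ((hclose (ψ k) t).trans (hk₂.trans_le (min_le_left _ _))).le
            (hγ₂ hparam).le
      _ = ε := add_halves ε
  -- re-index along the subsequence
  refine ⟨t₁, t₂, sStar, fun k => φ (ψ k), fun k => s (ψ k), ht₁, ht₂, fun k => ?_,
    fun k => hφs (ψ k), hlim, hT₁le, hconst⟩
  refine (hφ (ψ k)).trans_le (one_div_le_one_div_of_le (by positivity) ?_)
  exact_mod_cast Nat.add_le_add_right (hψ.le_apply (x := k)) 1

/-- **Final segments of curves at reparametrisation distance `0` are at distance `0`** (closed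
`F`). See the module docstring for the proof. [folklore] -/
theorem dist_startFrom_startFrom_eq_zero {F : Set E} (hF : IsClosed F) {γ₁ γ₂ : Curve E}
    (h : dist γ₁ γ₂ = 0) : dist (γ₁.startFrom F) (γ₂.startFrom F) = 0 := by
  by_cases hhit : ∃ t, γ₂ t ∈ F
  swap
  · -- neither curve meets `F`: both final segments are the constant curve at the common target
    have hhit₂ : ∀ t, γ₂ t ∉ F := fun t ht => hhit ⟨t, ht⟩
    rw [startFrom_eq_const_of_hitParam_eq_one
        (hitParam_eq_one_of_forall_notMem (forall_notMem_of_dist_eq_zero h hhit₂)),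
      startFrom_eq_const_of_hitParam_eq_one (hitParam_eq_one_of_forall_notMem hhit₂),
      target_eq_of_dist_eq_zero h, dist_self]
  obtain ⟨t₁, t₂, sStar, φ, s, ht₁, ht₂, hφ, hφs, hlim, hT₁le, hconst⟩ :=
    exists_reparam_pause hF h hhit
  rw [startFrom_eq_of_coe_eq ht₁, startFrom_eq_of_coe_eq ht₂]
  -- (a) pause removal: the tail of `γ₁` from `T₁` vs the tail from `s⋆`
  have hA : dist (⟨γ₁.toContinuousMap.comp (affineClamp t₁ (1 - t₁))⟩ : Curve E)
      ⟨γ₁.toContinuousMap.comp (affineClamp sStar (1 - sStar))⟩ = 0 :=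
    dist_tail_tail_eq_zero_of_const γ₁ t₁ sStar hT₁le hconst
  -- (b) the tail of `γ₁` from `s k` vs the tail of `γ₂` from `T₂`
  have hB : ∀ k, dist (⟨γ₁.toContinuousMap.comp (affineClamp (s k) (1 - s k))⟩ : Curve E)
      ⟨γ₂.toContinuousMap.comp (affineClamp t₂ (1 - t₂))⟩ ≤ 1 / ((k : ℝ) + 1) := by
    intro k
    calc _ ≤ dist (⟨γ₁.toContinuousMap.comp (affineClamp (s k) (1 - s k))⟩ : Curve E)
            ⟨(γ₂.reparam (φ k)).toContinuousMap.comp (affineClamp (s k) (1 - s k))⟩ +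
          dist (⟨(γ₂.reparam (φ k)).toContinuousMap.comp (affineClamp (s k) (1 - s k))⟩ : Curve E)
            ⟨γ₂.toContinuousMap.comp (affineClamp t₂ (1 - t₂))⟩ := dist_triangle _ _ _
      _ ≤ dist γ₁.toContinuousMap (γ₂.reparam (φ k)).toContinuousMap + 0 :=
          add_le_add (dist_comp_comp_le_dist _ _ _)
            (dist_tail_reparam_tail_eq_zero γ₂ (φ k) (s k) t₂ (hφs k)).le
      _ ≤ 1 / ((k : ℝ) + 1) := by
          rw [add_zero]
          exact (hφ k).le
  -- (c) pass to the limit `s k → s⋆`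
  have hC : dist (⟨γ₁.toContinuousMap.comp (affineClamp sStar (1 - sStar))⟩ : Curve E)
      ⟨γ₂.toContinuousMap.comp (affineClamp t₂ (1 - t₂))⟩ = 0 :=
    dist_eq_zero_of_tendsto
      (fun k => (⟨γ₁.toContinuousMap.comp (affineClamp (s k) (1 - s k))⟩ : Curve E))
      (tendsto_dist_comp_affineClamp γ₁ hlim (fun u => (u : ℝ)) (fun u => 1 - (u : ℝ))
        (fun u v => le_rfl) (fun u v => by rw [sub_sub_sub_cancel_left, abs_sub_comm]))
      (squeeze_zero (fun _ => dist_nonneg) hB tendsto_one_div_add_atTop_nhds_zero_nat)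
  refine le_antisymm ?_ dist_nonneg
  calc _ ≤ dist (⟨γ₁.toContinuousMap.comp (affineClamp t₁ (1 - t₁))⟩ : Curve E)
          ⟨γ₁.toContinuousMap.comp (affineClamp sStar (1 - sStar))⟩ +
        dist (⟨γ₁.toContinuousMap.comp (affineClamp sStar (1 - sStar))⟩ : Curve E)
          ⟨γ₂.toContinuousMap.comp (affineClamp t₂ (1 - t₂))⟩ := dist_triangle _ _ _
    _ = 0 := by rw [hA, hC, add_zero]

/-- **Initial segments of curves at reparametrisation distance `0` are at distance `0`**
(closed `F`). Same proof with heads instead of tails. [folklore] -/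
theorem dist_stopAt_stopAt_eq_zero {F : Set E} (hF : IsClosed F) {γ₁ γ₂ : Curve E}
    (h : dist γ₁ γ₂ = 0) : dist (γ₁.stopAt F) (γ₂.stopAt F) = 0 := by
  by_cases hhit : ∃ t, γ₂ t ∈ F
  swap
  · -- neither curve meets `F`: both initial segments are the whole curves
    have hhit₂ : ∀ t, γ₂ t ∉ F := fun t ht => hhit ⟨t, ht⟩
    rw [stopAt_eq_self_of_hitParam_eq_one
        (hitParam_eq_one_of_forall_notMem (forall_notMem_of_dist_eq_zero h hhit₂)),
      stopAt_eq_self_of_hitParam_eq_one (hitParam_eq_one_of_forall_notMem hhit₂), h]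
  obtain ⟨t₁, t₂, sStar, φ, s, ht₁, ht₂, hφ, hφs, hlim, hT₁le, hconst⟩ :=
    exists_reparam_pause hF h hhit
  rw [stopAt_eq_of_coe_eq ht₁, stopAt_eq_of_coe_eq ht₂]
  -- (a) pause removal: the head of `γ₁` up to `T₁` vs the head up to `s⋆`
  have hA : dist (⟨γ₁.toContinuousMap.comp (affineClamp 0 t₁)⟩ : Curve E)
      ⟨γ₁.toContinuousMap.comp (affineClamp 0 sStar)⟩ = 0 :=
    dist_head_head_eq_zero_of_const γ₁ t₁ sStar hT₁le hconst
  -- (b) the head of `γ₁` up to `s k` vs the head of `γ₂` up to `T₂`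
  have hB : ∀ k, dist (⟨γ₁.toContinuousMap.comp (affineClamp 0 (s k))⟩ : Curve E)
      ⟨γ₂.toContinuousMap.comp (affineClamp 0 t₂)⟩ ≤ 1 / ((k : ℝ) + 1) := by
    intro k
    calc _ ≤ dist (⟨γ₁.toContinuousMap.comp (affineClamp 0 (s k))⟩ : Curve E)
            ⟨(γ₂.reparam (φ k)).toContinuousMap.comp (affineClamp 0 (s k))⟩ +
          dist (⟨(γ₂.reparam (φ k)).toContinuousMap.comp (affineClamp 0 (s k))⟩ : Curve E)
            ⟨γ₂.toContinuousMap.comp (affineClamp 0 t₂)⟩ := dist_triangle _ _ _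
      _ ≤ dist γ₁.toContinuousMap (γ₂.reparam (φ k)).toContinuousMap + 0 :=
          add_le_add (dist_comp_comp_le_dist _ _ _)
            (dist_head_reparam_head_eq_zero γ₂ (φ k) (s k) t₂ (hφs k)).le
      _ ≤ 1 / ((k : ℝ) + 1) := by
          rw [add_zero]
          exact (hφ k).le
  -- (c) pass to the limit `s k → s⋆`
  have hC : dist (⟨γ₁.toContinuousMap.comp (affineClamp 0 sStar)⟩ : Curve E)
      ⟨γ₂.toContinuousMap.comp (affineClamp 0 t₂)⟩ = 0 :=
    dist_eq_zero_of_tendsto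
      (fun k => (⟨γ₁.toContinuousMap.comp (affineClamp 0 (s k))⟩ : Curve E))
      (tendsto_dist_comp_affineClamp γ₁ hlim (fun _ => (0 : ℝ)) (fun u => (u : ℝ))
        (fun u v => by rw [sub_self, abs_zero]; exact abs_nonneg _) (fun u v => le_rfl))
      (squeeze_zero (fun _ => dist_nonneg) hB tendsto_one_div_add_atTop_nhds_zero_nat)
  refine le_antisymm ?_ dist_nonneg
  calc _ ≤ dist (⟨γ₁.toContinuousMap.comp (affineClamp 0 t₁)⟩ : Curve E)
          ⟨γ₁.toContinuousMap.comp (affineClamp 0 sStar)⟩ +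
        dist (⟨γ₁.toContinuousMap.comp (affineClamp 0 sStar)⟩ : Curve E)
          ⟨γ₂.toContinuousMap.comp (affineClamp 0 t₂)⟩ := dist_triangle _ _ _
    _ = 0 := by rw [hA, hC, add_zero]

end Metric

end Curve

namespace CurveClass

/-- **Discharge of the named fact `CurveClass.startFrom_mk`** (representative independence of the
final segment from the first hitting of a closed set): `startFrom F (mk γ) = mk (γ.startFrom F)`,
because the chosen representative of `mk γ` is at reparametrisation distance `0` from `γ` and
`Curve.dist_startFrom_startFrom_eq_zero`. Fréchet re-parametrisation folklore; curve space of
Aizenman–Burchard, Duke Math. J. 99 (1999) §2.1. [folklore] -/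
theorem startFrom_mk_holds : startFrom_mk := by
  intro E _ F hF γ
  show mk ((mk γ).out.startFrom F) = mk (γ.startFrom F)
  exact mk_eq_mk_iff_dist_eq_zero.2
    (Curve.dist_startFrom_startFrom_eq_zero hF (mk_eq_mk_iff_dist_eq_zero.1 (mk_out (mk γ))))

/-- **Discharge of the named fact `CurveClass.stopAt_mk`** (representative independence of the
initial segment up to the first hitting of a closed set): `stopAt F (mk γ) = mk (γ.stopAt F)`, by
`Curve.dist_stopAt_stopAt_eq_zero`. Fréchet re-parametrisation folklore; curve space of
Aizenman–Burchard, Duke Math. J. 99 (1999) §2.1. [folklore] -/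
theorem stopAt_mk_holds : stopAt_mk := by
  intro E _ F hF γ
  show mk ((mk γ).out.stopAt F) = mk (γ.stopAt F)
  exact mk_eq_mk_iff_dist_eq_zero.2
    (Curve.dist_stopAt_stopAt_eq_zero hF (mk_eq_mk_iff_dist_eq_zero.1 (mk_out (mk γ))))

end CurveClass

end Literature.Probability.RandomPlanarGeometry
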